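import Literature.MathematicalPhysics.QuantumFieldTheory.Balaban1983to89.B9Eq343FlatWindowLetterOfLocalHolder
import Literature.MathematicalPhysics.QuantumFieldTheory.Balaban1983to89.B9Eq344LocalGradientFlat

/-!
# `Balaban1983to89.B9Eq344FlatWindowGradientLetter` — T. Bałaban, *Propagators for lattice gauge theories in a background field*, Commun. Math. Phys. **99** (1985)
# 389–434 [Balaban1985BackgroundPropagators] Thm 3.1 (3.44) p. 398 (*«|(∇_UG′(U)∇\*_Uλ)(x)| ≤ B′₀(ε)(…‖λ‖_ε… + |λ|)»*), (3.40) p. 397, with [Balaban1984PropagatorsII]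
# (1.9) p. 226: **`HflatW∇` — THE WINDOWED, `cosh`-WEIGHTED FLAT GRADIENT LETTER FOR DIVERGENCE-FORM η-HÖLDER DATA, FROM THE LOCAL LETTER `Hloc∇`, AND HENCE PROVED**:
# on `TSite d (towerP L m (n+1))`, for `(Δ^η_1+1)u = D^{η*}_1 f`, a rate `a` inside the Combes–Thomas window `aL^{n+1} ≤ 1`, `2d(L^{n+1})²(cosh a − 1) ≤ ½`, a centre
# `x₀` and data with `‖f(b)‖ ≤ F·W_{x₀}(b₋)` and `‖f(y′,μ) − f(y,μ)‖ ≤ H·W_{x₀}(y)·(tdist(y,y′)∕L^{n+1})^{½}` (`tdist(y,y′) ≤ L^{n+1}`), `W_{x₀} = Π_μ cosh(a·circdist)`: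
# `L^{n+1}·‖u(x+e_μ) − u(x)‖ ≤ C∇·(16d+2)·e^{4d}·(F + H)·W_{x₀}(x)` at EVERY `x` — the weighted η-scale GRADIENT row of the flat `(Δ^η+1)⁻¹D^{η*}` on Hölder
# data (print's (3.44) shape at `A = 0`, with the window g93 found necessary).  The reduction is gen 93's H-F verbatim (weighted sup row `≤ 16d·F·W`,
# `B9Eq342CovariantResolventAdjointRowLetters.norm_apply_le_weighted_of_flat_resolvent_covDiv` + `sad_le_sixteen_mul`; weight distortion `≤ e^{4d}` over the ball
# of radius `4L^{n+1}`, `B9Eq343CovariantResolventHolderLetters.weight_le_exp_mul_of_tdist_le`); the local letter is `B9Eq344LocalGradientFlat.exists_localGradient_flat`.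
# NE9 crux-team LEAF PROVER 01, gen 95 — the flat half of (L2), the gradient row of `(Δ^η_U+1)⁻¹D*_U` on Hölder data, by which STOREY H's `H3` is re-docked WITHOUT (HLb).

statement-level skeleton of published theorems with citation tags; proofs where landed; nothing here is a claim about the Yang–Mills mass gap

CITATION HEADER (lean-in-tree rule).  Audit cell `pub-balaban`, sub-cell `t4`, BINDER row NE9; filed by NE9 crux-team LEAF PROVER 01 (`b2b-balaban-t4-ne9-formalise-leaf-01`,
gen 95; bears_on: R4/N22).  Source READ first-hand (`paper:balaban1985-cmp99-background-propagators`, pp. 394–398).  COMPOSED BY NAME from the imports (pattern: gen 93's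
`B9Eq343FlatWindowLetterOfLocalHolder.flatWindowLetter_of_localHolder`).  Nothing printed is a hypothesis.

WHAT IS PROVED (sorry-free; proof lane — 0 `def`).
* **`flatWindowGradientLetter_of_localGradient`** — `HflatW∇` ⇐ `Hloc∇` (displayed, the conclusion shape of `B9Eq344LocalGradientFlat.exists_localGradient_flat`), constant
  `C∇·(16d+2)·e^{4d}`: on the ball `tdist(x,·) ≤ 4L^{n+1}` the weighted sup row bounds `u` by `16d·F·e^{4d}·W_{x₀}(x)` and the data's local `½`-Hölder modulus is
  `≤ (H + 2F)·e^{4d}·W_{x₀}(x)` (pairs farther than `L^{n+1}` apart by the sup bound, since `(tdist∕L^{n+1})^{½} ≥ 1` there).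
* **`flatWindowGradientLetter`** — `HflatW∇` HOLDS: `∃ SG ≥ 0` (depending on `d` only) with the displayed conclusion for all `L ≥ 2`, heights, periods, windows, centres, data.
HONEST SCOPE.  A FLAT weighted gradient letter PROVED; the covariant perturbation ((L2) on the model: gradient row of `(Δ^η_U+1)⁻¹D*_U` on Hölder data, by the NON-divergence
split of `Δ_U − Δ_1` and a bootstrap) and the re-docking of `H3` are the successor's files.  NOT summit progress (cell pub-balaban: NE9 NOT PRINTED ∕ NOT PROVED; «NE9 ⇐ the
named binders»; row WALLED ON A MODEL (O-NE9-1; #5 UNRULED); spine PROVED 0∕9; rung (B)+1 finite T⁴ — NOT infinite volume, NOT mass gap, NOT BetaPertH, NOT Clay).  HONEST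
DEPENDENCY (cell line): continuum YM on T⁴ ⇐ BetaPertH ∧ nine spine estimates (0/9 proved); BetaPertH ⇐ (D1) ∧ (D4) ∧ CAP+tail; G-an2-4 gates asym, D1 and NE2/3/4.  NEW
file; nothing modified.  Net new unproved facts: 0.
-/

noncomputable section

set_option autoImplicit false

open scoped InnerProductSpace ComplexConjugate BigOperators

namespace Literature.MathematicalPhysics.QuantumFieldTheory.Balaban1983to89.B9Eq344FlatWindowGradientLetter

open B4Sect5Torus (TSite tdist tdist_nonneg tdist_symm)
open B4TorusKernel.MultiPeriod (circAbs)
open B9SectCLatticeCarrier (Bond bpos shift)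
open B9Eq311L2Pairing (WL2)
open B11Eq103H1Complex (SiteL2K BondL2K covDivL2K covLaplaceSiteK)
open B9Eq315QTower (towerP towerP_apply)
open B9Eq342CovariantResolventAdjointRowLetters (norm_apply_le_weighted_of_flat_resolvent_covDiv)
open B9Eq342CovariantResolventAdjointRowTower (sad_le_sixteen_mul)
open B9Eq343CovariantResolventHolderLetters (weight_le_exp_mul_of_tdist_le)
open B9Eq344LocalGradientFlat (exists_localGradient_flat)

variable {d : ℕ} (L : ℕ) [NeZero L] {W : Type*} [NormedAddCommGroup W] [InnerProductSpace ℂ W]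

/-- **`HflatW∇` ⇐ `Hloc∇`: the windowed, `cosh`-weighted flat GRADIENT letter for η-Hölder divergence-form data from the LOCAL gradient letter**, constant
`C∇·(16d+2)·e^{4d}` — the weighted sup row of the flat resolvent (`≤ 16d·F·W_{x₀}` inside the window) and the weight's distortion `≤ e^{4d}` over the ball
`tdist(x,·) ≤ 4L^{n+1}` (`aL^{n+1} ≤ 1`) turn the local letters `sup‖u‖ ≤ M_z` and the local `½`-Hölder modulus of `f` into multiples of `(F + H)·W_{x₀}(x)`.
[folklore] [cite: Balaban1985BackgroundPropagators, Thm 3.1 (3.44) p.398, (3.40) p.397] [cite: Balaban1984PropagatorsII, (1.9) p.226] -/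
theorem flatWindowGradientLetter_of_localGradient (hL2 : 2 ≤ L) (Cg : ℝ) (hCg : 0 ≤ Cg)
    (Hloc : ∀ (n : ℕ) (η : ℝ), η * (L : ℝ) ^ (n + 1) = 1 → ∀ (c₀ : ℝ) [Fact (0 < c₀)] (m : Fin d → ℕ) [∀ i, NeZero (m i)]
      (z : SiteL2K ℂ d (towerP L m (n + 1)) c₀ W) (f : BondL2K ℂ d (towerP L m (n + 1)) c₀ W) (x : TSite d (towerP L m (n + 1))) (Mz Hf : ℝ), 0 ≤ Mz → 0 ≤ Hf →
      covLaplaceSiteK ((η⁻¹ : ℝ) : ℂ) (fun _ : Bond d (towerP L m (n + 1)) => (LinearMap.id : W →ₗ[ℂ] W)) (fun _ => LinearMap.id) z + ((1 : ℝ) : ℂ) • z =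
        covDivL2K ℂ c₀ ((η⁻¹ : ℝ) : ℂ) (fun _ : Bond d (towerP L m (n + 1)) => (LinearMap.id : W →ₗ[ℂ] W)) f →
      (∀ y, tdist (towerP L m (n + 1)) x y ≤ 4 * (L : ℝ) ^ (n + 1) → ‖WL2.equiv ℂ (fun _ : TSite d (towerP L m (n + 1)) => c₀) W z y‖ ≤ Mz) →
      (∀ (y y' : TSite d (towerP L m (n + 1))) (μ : Fin d), tdist (towerP L m (n + 1)) x y ≤ 4 * (L : ℝ) ^ (n + 1) →
        tdist (towerP L m (n + 1)) x y' ≤ 4 * (L : ℝ) ^ (n + 1) →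
        ‖WL2.equiv ℂ (fun _ : Bond d (towerP L m (n + 1)) => c₀) W f (y', μ) - WL2.equiv ℂ (fun _ : Bond d (towerP L m (n + 1)) => c₀) W f (y, μ)‖ ≤
          Hf * (tdist (towerP L m (n + 1)) y y' / (L : ℝ) ^ (n + 1)) ^ ((1 : ℝ) / 2)) →
      ∀ μ : Fin d, (L : ℝ) ^ (n + 1) * ‖WL2.equiv ℂ (fun _ : TSite d (towerP L m (n + 1)) => c₀) W z (shift μ x) -
          WL2.equiv ℂ (fun _ : TSite d (towerP L m (n + 1)) => c₀) W z x‖ ≤ Cg * (Mz + Hf)) :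
    ∀ (n : ℕ) (η : ℝ), η * (L : ℝ) ^ (n + 1) = 1 → ∀ (c₀ : ℝ) [Fact (0 < c₀)] (m : Fin d → ℕ) [∀ i, NeZero (m i)] (a : ℝ), 0 ≤ a →
      a * (L : ℝ) ^ (n + 1) ≤ 1 → 2 * (d : ℝ) * ((L : ℝ) ^ (n + 1)) ^ 2 * (Real.cosh a - 1) ≤ 1 / 2 →
      ∀ (x₀ : TSite d (towerP L m (n + 1))) (u : SiteL2K ℂ d (towerP L m (n + 1)) c₀ W) (f : BondL2K ℂ d (towerP L m (n + 1)) c₀ W) (F H : ℝ),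
      0 ≤ F → 0 ≤ H → covLaplaceSiteK ((η⁻¹ : ℝ) : ℂ) (fun _ : Bond d (towerP L m (n + 1)) => (LinearMap.id : W →ₗ[ℂ] W)) (fun _ => LinearMap.id) u + ((1 : ℝ) : ℂ) • u =
        covDivL2K ℂ c₀ ((η⁻¹ : ℝ) : ℂ) (fun _ : Bond d (towerP L m (n + 1)) => (LinearMap.id : W →ₗ[ℂ] W)) f →
      (∀ b, ‖WL2.equiv ℂ (fun _ : Bond d (towerP L m (n + 1)) => c₀) W f b‖ ≤ F * ∏ μ, Real.cosh (a * (circAbs (towerP L m (n + 1) μ) ((((x₀ μ : ℕ) : ZMod (towerP L m (n + 1) μ)) - ((bpos b μ : ℕ) : ZMod (towerP L m (n + 1) μ))).val) : ℝ))) →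
      (∀ (y y' : TSite d (towerP L m (n + 1))) (μ : Fin d), tdist (towerP L m (n + 1)) y y' ≤ (L : ℝ) ^ (n + 1) →
        ‖WL2.equiv ℂ (fun _ : Bond d (towerP L m (n + 1)) => c₀) W f (y', μ) - WL2.equiv ℂ (fun _ : Bond d (towerP L m (n + 1)) => c₀) W f (y, μ)‖ ≤
          H * (∏ μ, Real.cosh (a * (circAbs (towerP L m (n + 1) μ) ((((x₀ μ : ℕ) : ZMod (towerP L m (n + 1) μ)) - ((y μ : ℕ) : ZMod (towerP L m (n + 1) μ))).val) : ℝ))) *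
            (tdist (towerP L m (n + 1)) y y' / (L : ℝ) ^ (n + 1)) ^ ((1 : ℝ) / 2)) →
      ∀ (x : TSite d (towerP L m (n + 1))) (μ : Fin d),
        (L : ℝ) ^ (n + 1) * ‖WL2.equiv ℂ (fun _ : TSite d (towerP L m (n + 1)) => c₀) W u (shift μ x) - WL2.equiv ℂ (fun _ : TSite d (towerP L m (n + 1)) => c₀) W u x‖ ≤
          Cg * (16 * (d : ℝ) + 2) * Real.exp (4 * (d : ℝ)) * (F + H) * ∏ μ, Real.cosh (a * (circAbs (towerP L m (n + 1) μ) ((((x₀ μ : ℕ) : ZMod (towerP L m (n + 1) μ)) - ((x μ : ℕ) : ZMod (towerP L m (n + 1) μ))).val) : ℝ)) := by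
  intro n η hηL c₀ _ m _ a ha0 haK hwin x₀ u f F H hF hH hu hf hfH x μ
  have hK1 : (1 : ℝ) ≤ (L : ℝ) ^ (n + 1) := one_le_pow₀ (by exact_mod_cast (by omega : 1 ≤ L))
  have hK0 : (0 : ℝ) < (L : ℝ) ^ (n + 1) := lt_of_lt_of_le one_pos hK1
  have hη0 : 0 < η := by nlinarith only [hηL, hK0]
  have hηK : η⁻¹ = (L : ℝ) ^ (n + 1) := inv_eq_of_mul_eq_one_right hηL
  have hd0 : (0 : ℝ) ≤ d := Nat.cast_nonneg d
  have hm1 : ∀ i, 1 ≤ m i := fun i => Nat.one_le_iff_ne_zero.mpr (NeZero.ne (m i))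
  have hP1 : ∀ i, 1 ≤ towerP L m (n + 1) i := fun i => by
    rw [towerP_apply]; exact Nat.one_le_iff_ne_zero.2 (Nat.mul_ne_zero (pow_ne_zero _ (NeZero.ne L)) (NeZero.ne (m i)))
  have hn2 : ∀ ν : Fin d, 2 ≤ towerP L m (n + 1) ν := fun ν => by
    rw [towerP_apply]
    calc 2 ≤ L ^ 1 * 1 := by rw [pow_one, mul_one]; omega
      _ ≤ L ^ (n + 1) * m ν := Nat.mul_le_mul (Nat.pow_le_pow_right (by omega) (by omega)) (hm1 ν)
  have hPK : ∀ ν : Fin d, η⁻¹ ≤ (towerP L m (n + 1) ν : ℝ) := fun ν => by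
    rw [hηK, towerP_apply, Nat.cast_mul, Nat.cast_pow]
    exact le_mul_of_one_le_right hK0.le (by exact_mod_cast hm1 ν)
  have ha1 : a ≤ 1 := by nlinarith only [haK, hK1, ha0]
  have hat : a * η⁻¹ ≤ 1 := by rw [hηK]; exact haK
  have hlam : 1 / 2 ≤ 1 - 2 * (d : ℝ) * η⁻¹ ^ 2 * (Real.cosh a - 1) := by rw [hηK]; linarith only [hwin]
  have hlam' : 2 * (d : ℝ) * η⁻¹ ^ 2 * (Real.cosh a - 1) < 1 := by linarith only [hlam]
  -- the weighted sup row of the flat resolvent, constant `≤ 16d`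
  have hSad := sad_le_sixteen_mul (towerP L m (n + 1)) (t := η⁻¹) (a := a) (by rw [hηK]; exact hK1) ha0 ha1 hat hlam hPK
  have hW0 : ∀ y : TSite d (towerP L m (n + 1)),
      0 ≤ ∏ μ, Real.cosh (a * (circAbs (towerP L m (n + 1) μ) ((((x₀ μ : ℕ) : ZMod (towerP L m (n + 1) μ)) - ((y μ : ℕ) : ZMod (towerP L m (n + 1) μ))).val) : ℝ)) :=
    fun y => Finset.prod_nonneg fun _ _ => (Real.cosh_pos _).le
  have hrow : ∀ y, ‖WL2.equiv ℂ (fun _ : TSite d (towerP L m (n + 1)) => c₀) W u y‖ ≤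
      16 * d * F * ∏ μ, Real.cosh (a * (circAbs (towerP L m (n + 1) μ) ((((x₀ μ : ℕ) : ZMod (towerP L m (n + 1) μ)) - ((y μ : ℕ) : ZMod (towerP L m (n + 1) μ))).val) : ℝ)) :=
    fun y => (norm_apply_le_weighted_of_flat_resolvent_covDiv (P := towerP L m (n + 1)) η⁻¹ (inv_pos.2 hη0) one_pos ha0 hlam' hn2 hu x₀ hf y).trans
      (mul_le_mul_of_nonneg_right (mul_le_mul_of_nonneg_right hSad hF) (hW0 y))
  -- the weight over the ball `d(x, ·) ≤ 4L^{n+1}`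
  have he4 : Real.exp (a * d * (4 * (L : ℝ) ^ (n + 1))) ≤ Real.exp (4 * (d : ℝ)) :=
    Real.exp_le_exp.2 (by nlinarith only [mul_le_mul_of_nonneg_left haK hd0, ha0, hd0])
  set Wx : ℝ := ∏ μ, Real.cosh (a * (circAbs (towerP L m (n + 1) μ) ((((x₀ μ : ℕ) : ZMod (towerP L m (n + 1) μ)) - ((x μ : ℕ) : ZMod (towerP L m (n + 1) μ))).val) : ℝ)) with hWxdef
  have hWx0 : 0 ≤ Wx := hW0 x
  have hWx : ∀ p : TSite d (towerP L m (n + 1)), tdist (towerP L m (n + 1)) x p ≤ 4 * (L : ℝ) ^ (n + 1) →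
      ∏ μ, Real.cosh (a * (circAbs (towerP L m (n + 1) μ) ((((x₀ μ : ℕ) : ZMod (towerP L m (n + 1) μ)) - ((p μ : ℕ) : ZMod (towerP L m (n + 1) μ))).val) : ℝ)) ≤
        Real.exp (4 * (d : ℝ)) * Wx :=
    fun p hp => (weight_le_exp_mul_of_tdist_le (P := towerP L m (n + 1)) ha0 x₀ x p (by rw [tdist_symm hP1]; exact hp)).trans
      (mul_le_mul_of_nonneg_right he4 hWx0)
  -- the local sup letter for `u`
  have hMu : ∀ y, tdist (towerP L m (n + 1)) x y ≤ 4 * (L : ℝ) ^ (n + 1) → ‖WL2.equiv ℂ (fun _ : TSite d (towerP L m (n + 1)) => c₀) W u y‖ ≤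
      16 * d * F * (Real.exp (4 * (d : ℝ)) * Wx) :=
    fun y hy => (hrow y).trans (mul_le_mul_of_nonneg_left (hWx y hy) (by positivity))
  -- the local `½`-Hölder modulus of the data: `(H + 2F)·e^{4d}·W(x)`
  have hHf : ∀ (y y' : TSite d (towerP L m (n + 1))) (ν : Fin d), tdist (towerP L m (n + 1)) x y ≤ 4 * (L : ℝ) ^ (n + 1) →
      tdist (towerP L m (n + 1)) x y' ≤ 4 * (L : ℝ) ^ (n + 1) →
      ‖WL2.equiv ℂ (fun _ : Bond d (towerP L m (n + 1)) => c₀) W f (y', ν) - WL2.equiv ℂ (fun _ : Bond d (towerP L m (n + 1)) => c₀) W f (y, ν)‖ ≤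
        (H + 2 * F) * (Real.exp (4 * (d : ℝ)) * Wx) * (tdist (towerP L m (n + 1)) y y' / (L : ℝ) ^ (n + 1)) ^ ((1 : ℝ) / 2) := by
    intro y y' ν hy hy'
    have hq0 : 0 ≤ tdist (towerP L m (n + 1)) y y' / (L : ℝ) ^ (n + 1) := div_nonneg (tdist_nonneg _ y y') hK0.le
    have hr0 : 0 ≤ (tdist (towerP L m (n + 1)) y y' / (L : ℝ) ^ (n + 1)) ^ ((1 : ℝ) / 2) := Real.rpow_nonneg hq0 _
    have hWy := hWx y hy
    have hWy' := hWx y' hy'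
    by_cases hnear : tdist (towerP L m (n + 1)) y y' ≤ (L : ℝ) ^ (n + 1)
    · calc ‖WL2.equiv ℂ (fun _ : Bond d (towerP L m (n + 1)) => c₀) W f (y', ν) - WL2.equiv ℂ (fun _ : Bond d (towerP L m (n + 1)) => c₀) W f (y, ν)‖
          ≤ H * (∏ μ, Real.cosh (a * (circAbs (towerP L m (n + 1) μ) ((((x₀ μ : ℕ) : ZMod (towerP L m (n + 1) μ)) - ((y μ : ℕ) : ZMod (towerP L m (n + 1) μ))).val) : ℝ))) *
              (tdist (towerP L m (n + 1)) y y' / (L : ℝ) ^ (n + 1)) ^ ((1 : ℝ) / 2) := hfH y y' ν hnear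
        _ ≤ H * (Real.exp (4 * (d : ℝ)) * Wx) * (tdist (towerP L m (n + 1)) y y' / (L : ℝ) ^ (n + 1)) ^ ((1 : ℝ) / 2) :=
            mul_le_mul_of_nonneg_right (mul_le_mul_of_nonneg_left hWy hH) hr0
        _ ≤ (H + 2 * F) * (Real.exp (4 * (d : ℝ)) * Wx) * (tdist (towerP L m (n + 1)) y y' / (L : ℝ) ^ (n + 1)) ^ ((1 : ℝ) / 2) := by
            apply mul_le_mul_of_nonneg_right _ hr0
            apply mul_le_mul_of_nonneg_right (by linarith) (by positivity)
    · -- far pairs: the sup bound, and `(tdist/L^{n+1})^{1/2} ≥ 1`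
      have hge : (1 : ℝ) ≤ (tdist (towerP L m (n + 1)) y y' / (L : ℝ) ^ (n + 1)) ^ ((1 : ℝ) / 2) :=
        Real.one_le_rpow (by rw [le_div_iff₀ hK0]; linarith) (by norm_num)
      have h1 : ‖WL2.equiv ℂ (fun _ : Bond d (towerP L m (n + 1)) => c₀) W f (y', ν)‖ ≤ F * (Real.exp (4 * (d : ℝ)) * Wx) :=
        (hf (y', ν)).trans (mul_le_mul_of_nonneg_left hWy' hF)
      have h2 : ‖WL2.equiv ℂ (fun _ : Bond d (towerP L m (n + 1)) => c₀) W f (y, ν)‖ ≤ F * (Real.exp (4 * (d : ℝ)) * Wx) :=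
        (hf (y, ν)).trans (mul_le_mul_of_nonneg_left hWy hF)
      have h3 : 0 ≤ (H + 2 * F) * (Real.exp (4 * (d : ℝ)) * Wx) := by positivity
      have hHW : 0 ≤ H * (Real.exp (4 * (d : ℝ)) * Wx) := by positivity
      calc ‖WL2.equiv ℂ (fun _ : Bond d (towerP L m (n + 1)) => c₀) W f (y', ν) - WL2.equiv ℂ (fun _ : Bond d (towerP L m (n + 1)) => c₀) W f (y, ν)‖
          ≤ F * (Real.exp (4 * (d : ℝ)) * Wx) + F * (Real.exp (4 * (d : ℝ)) * Wx) := (norm_sub_le _ _).trans (add_le_add h1 h2)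
        _ ≤ (H + 2 * F) * (Real.exp (4 * (d : ℝ)) * Wx) * 1 := by linarith
        _ ≤ (H + 2 * F) * (Real.exp (4 * (d : ℝ)) * Wx) * (tdist (towerP L m (n + 1)) y y' / (L : ℝ) ^ (n + 1)) ^ ((1 : ℝ) / 2) :=
            mul_le_mul_of_nonneg_left hge h3
  have h := Hloc n η hηL c₀ m u f x _ _ (by positivity) (by positivity) hu hMu hHf μ
  refine h.trans ?_
  have hE0 : 0 ≤ Real.exp (4 * (d : ℝ)) * Wx := by positivity
  have hkey : 16 * d * F * (Real.exp (4 * (d : ℝ)) * Wx) + (H + 2 * F) * (Real.exp (4 * (d : ℝ)) * Wx) ≤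
      (16 * (d : ℝ) + 2) * Real.exp (4 * (d : ℝ)) * (F + H) * Wx := by
    have : 16 * d * F + (H + 2 * F) ≤ (16 * (d : ℝ) + 2) * (F + H) := by nlinarith
    calc 16 * d * F * (Real.exp (4 * (d : ℝ)) * Wx) + (H + 2 * F) * (Real.exp (4 * (d : ℝ)) * Wx)
        = (16 * d * F + (H + 2 * F)) * (Real.exp (4 * (d : ℝ)) * Wx) := by ring
      _ ≤ (16 * (d : ℝ) + 2) * (F + H) * (Real.exp (4 * (d : ℝ)) * Wx) := mul_le_mul_of_nonneg_right this hE0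
      _ = (16 * (d : ℝ) + 2) * Real.exp (4 * (d : ℝ)) * (F + H) * Wx := by ring
  calc Cg * (16 * d * F * (Real.exp (4 * (d : ℝ)) * Wx) + (H + 2 * F) * (Real.exp (4 * (d : ℝ)) * Wx))
      ≤ Cg * ((16 * (d : ℝ) + 2) * Real.exp (4 * (d : ℝ)) * (F + H) * Wx) := mul_le_mul_of_nonneg_left hkey hCg
    _ = Cg * (16 * (d : ℝ) + 2) * Real.exp (4 * (d : ℝ)) * (F + H) * Wx := by ring

/-- **`HflatW∇` HOLDS**: there is `SG ≥ 0` (depending only on `d`) such that for every `L ≥ 2`, height `n`, periods `m`, weight `c₀`, windowed rate `a`, centre `x₀` and data as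
displayed, `L^{n+1}·‖u(x+e_μ) − u(x)‖ ≤ SG·(F + H)·W_{x₀}(x)` at every site and direction — `flatWindowGradientLetter_of_localGradient` with `Hloc∇ :=
B9Eq344LocalGradientFlat.exists_localGradient_flat`. [folklore] [cite: Balaban1985BackgroundPropagators, Thm 3.1 (3.44) p.398] [cite: Balaban1984PropagatorsII, (1.9) p.226] -/
theorem flatWindowGradientLetter (hL2 : 2 ≤ L) : ∃ SG : ℝ, 0 ≤ SG ∧
    ∀ (n : ℕ) (η : ℝ), η * (L : ℝ) ^ (n + 1) = 1 → ∀ (c₀ : ℝ) [Fact (0 < c₀)] (m : Fin d → ℕ) [∀ i, NeZero (m i)] (a : ℝ), 0 ≤ a →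
      a * (L : ℝ) ^ (n + 1) ≤ 1 → 2 * (d : ℝ) * ((L : ℝ) ^ (n + 1)) ^ 2 * (Real.cosh a - 1) ≤ 1 / 2 →
      ∀ (x₀ : TSite d (towerP L m (n + 1))) (u : SiteL2K ℂ d (towerP L m (n + 1)) c₀ W) (f : BondL2K ℂ d (towerP L m (n + 1)) c₀ W) (F H : ℝ),
      0 ≤ F → 0 ≤ H → covLaplaceSiteK ((η⁻¹ : ℝ) : ℂ) (fun _ : Bond d (towerP L m (n + 1)) => (LinearMap.id : W →ₗ[ℂ] W)) (fun _ => LinearMap.id) u + ((1 : ℝ) : ℂ) • u =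
        covDivL2K ℂ c₀ ((η⁻¹ : ℝ) : ℂ) (fun _ : Bond d (towerP L m (n + 1)) => (LinearMap.id : W →ₗ[ℂ] W)) f →
      (∀ b, ‖WL2.equiv ℂ (fun _ : Bond d (towerP L m (n + 1)) => c₀) W f b‖ ≤ F * ∏ μ, Real.cosh (a * (circAbs (towerP L m (n + 1) μ) ((((x₀ μ : ℕ) : ZMod (towerP L m (n + 1) μ)) - ((bpos b μ : ℕ) : ZMod (towerP L m (n + 1) μ))).val) : ℝ))) →
      (∀ (y y' : TSite d (towerP L m (n + 1))) (μ : Fin d), tdist (towerP L m (n + 1)) y y' ≤ (L : ℝ) ^ (n + 1) →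
        ‖WL2.equiv ℂ (fun _ : Bond d (towerP L m (n + 1)) => c₀) W f (y', μ) - WL2.equiv ℂ (fun _ : Bond d (towerP L m (n + 1)) => c₀) W f (y, μ)‖ ≤
          H * (∏ μ, Real.cosh (a * (circAbs (towerP L m (n + 1) μ) ((((x₀ μ : ℕ) : ZMod (towerP L m (n + 1) μ)) - ((y μ : ℕ) : ZMod (towerP L m (n + 1) μ))).val) : ℝ))) *
            (tdist (towerP L m (n + 1)) y y' / (L : ℝ) ^ (n + 1)) ^ ((1 : ℝ) / 2)) →
      ∀ (x : TSite d (towerP L m (n + 1))) (μ : Fin d),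
        (L : ℝ) ^ (n + 1) * ‖WL2.equiv ℂ (fun _ : TSite d (towerP L m (n + 1)) => c₀) W u (shift μ x) - WL2.equiv ℂ (fun _ : TSite d (towerP L m (n + 1)) => c₀) W u x‖ ≤
          SG * (F + H) * ∏ μ, Real.cosh (a * (circAbs (towerP L m (n + 1) μ) ((((x₀ μ : ℕ) : ZMod (towerP L m (n + 1) μ)) - ((x μ : ℕ) : ZMod (towerP L m (n + 1) μ))).val) : ℝ)) := by
  obtain ⟨Cg, hCg0, hCg⟩ := exists_localGradient_flat (d := d) L (W := W)
  refine ⟨Cg * (16 * (d : ℝ) + 2) * Real.exp (4 * (d : ℝ)), by positivity, ?_⟩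
  intro n η hηL c₀ _ m _ a ha0 haK hwin x₀ u f F H hF hH hu hf hfH x μ
  exact flatWindowGradientLetter_of_localGradient L hL2 Cg hCg0 hCg n η hηL c₀ m a ha0 haK hwin x₀ u f F H hF hH hu hf hfH x μ

end Literature.MathematicalPhysics.QuantumFieldTheory.Balaban1983to89.B9Eq344FlatWindowGradientLetter

end
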